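import Mathlib
import Summits.Ventures.HodgeRepro2.Tier7.Line3.KappaNatural
import Summits.Ventures.HodgeRepro2.Tier7.Line3.KappaBound

/-!
# Tier 7 — LINE 3 support: the finite-place fields from the LOCAL torus-translate condition (non-split places)
(`Line3/KappaDataFinLocal.lean`; t7-L1-p5, gen 2; option (i) of t7-crit-2's OBJECTION (G), STATUS l. 15466)

`KappaDataFin` / `KappaDataFinSplit` derive `KappaData`'s finite fields from clauses on ONE global matrix `matO γ` at every
place at once; the RTF's support condition is ADELIC — at each place `w` a LOCAL torus translate `t_A⁻¹ γ t_B` lies in `K_w`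
(resp. in `γ₀ K_N` at `v₁`) — and a single global representative with all local properties need not exist (crit-2 (G)).
This file types the fields from the local condition itself, at a place `w` of `K` that is inert or ramified in `E`, where
`E ⊗ F_w = E_w` is a FIELD with involution `σ_w` and p1's model applies over it:
* the completion `ψ_w : E →+* E_w` intertwines `σ` and `σ_w`; the global invariant is read locally by `kappa_map`
  (`kappa_local`: `ψ_w (κ(matO γ)) = κ_w ((matO γ).map ψ_w)` for the local adapted data `ψ_w ∘ d`, `ψ_w ∘∘ f`);
* `abv_w` a non-archimedean `σ_w`-invariant absolute value of `E_w` with `hw : w x = abv_w (ψ_w (algebraMap K E x))`;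
* the support clause per `γ` is LOCAL and TORUS-INVARIANT — `∃ a b t′` over `E_w` with `N(a 0) = N(b 0) = 1`,
  `ActsOn f_w t′ b` and the translate `diagonal a · (matO γ).map ψ_w · t′` integral (`hout`) / of size `≤ M` (`hS`) /
  equal to `γ₀_w · k` with `k ≡ 1 mod q⁻¹ ^ N` (`hcong`) — «`t_A⁻¹ γ t_B ∈ K_w`» resp. «`∈ γ₀ K_N`» in the adapted
  coordinates at `w`; κ is invariant under the translate (p1's `kappa_diag_mul` over `E_w`), so x1's bounds give
  **`hout_field_local` / `hS_field_local` / `hcong_field_local`** — `KappaData`'s fields (x1's `FinKappa` clauses) at `w`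
  with no global representative and no torus class number.
Split places are not covered here (`E ⊗ F_w` is not a field: memo §2c's `GL₂` picture). What stays in words: that the
real `K_w` / `K_N(v₁)` ARE the integral / congruence matrices in the adapted coordinates at `w` (the dictionary), and
the choice of `E_w`, `ψ_w`, `abv_w` above `w` (restriction = `hw`). Nothing about periods or (N). Pure algebra.
Sorry-free; axioms: propext / Classical.choice / Quot.sound. §8(d): uses an L-value-free non-vanishing device: NO.
-/

namespace Summit.Ventures.HodgeRepro2.Tier7.Line3.KappaDataFinLocal

open NumberField Matrix Summit.Ventures.HodgeRepro2.T7SupportTwoTorusInvariant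
  Summit.Ventures.HodgeRepro2.Tier7.Line3.KappaNatural Summit.Ventures.HodgeRepro2.Tier7.Line3.KappaBound
  Summit.Ventures.HodgeRepro2.Tier7.Line3.KappaCongruence

variable {E Ew K : Type*} [Field E] [Field Ew] [Field K] [NumberField K] [Algebra K E] (σ : E →+* E)
  (σw : Ew →+* Ew) (ψ : E →+* Ew) (abv : AbsoluteValue Ew ℝ) (d : Fin 2 → E) (f : Fin 2 → Fin 2 → E)
  {Orb : Type*} (matO : Orb → Matrix (Fin 2) (Fin 2) E) (κF : Orb → K) (w : FinitePlace K)

/-- the global invariant read in the completion: the local invariant of the local adapted data -/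
theorem kappa_local (hψ : ∀ x, ψ (σ x) = σw (ψ x)) (γ : Orb) :
    ψ (kappa σ d f (matO γ)) =
      kappa σw (fun i => ψ (d i)) (fun j i => ψ (f j i)) ((matO γ).map ψ) :=
  kappa_map σ σw ψ hψ d f (matO γ)

/-- the place of `K` applied to a difference of global invariants, read in the completion -/
theorem place_sub_eq_abv_local (hψ : ∀ x, ψ (σ x) = σw (ψ x))
    (hw : ∀ x : K, w x = abv (ψ (algebraMap K E x)))
    (hκ : ∀ γ, algebraMap K E (κF γ) = kappa σ d f (matO γ)) (γ γ₀ : Orb) :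
    w (κF γ - κF γ₀) = abv (kappa σw (fun i => ψ (d i)) (fun j i => ψ (f j i)) ((matO γ).map ψ) -
      kappa σw (fun i => ψ (d i)) (fun j i => ψ (f j i)) ((matO γ₀).map ψ)) := by
  rw [hw, map_sub, map_sub, hκ, hκ, kappa_local σ σw ψ d f matO hψ, kappa_local σ σw ψ d f matO hψ]

/-- **the local torus-translate clause**: `t_A⁻¹ γ t_B` (in the adapted coordinates at `w`) is the matrix `m` -/
def IsTranslate (fw : Fin 2 → Fin 2 → Ew) (g m : Matrix (Fin 2) (Fin 2) Ew) : Prop :=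
  ∃ (a b : Fin 2 → Ew) (t' : Matrix (Fin 2) (Fin 2) Ew), nrm σw (a 0) = 1 ∧ nrm σw (b 0) = 1 ∧
    ActsOn fw t' b ∧ m = diagonal a * g * t'

/-- κ is invariant under the local torus translate (p1's `kappa_diag_mul` over `E_w`) -/
theorem kappa_eq_of_isTranslate (dw : Fin 2 → Ew) (fw : Fin 2 → Fin 2 → Ew) {g m : Matrix (Fin 2) (Fin 2) Ew}
    (h : IsTranslate σw fw g m) : kappa σw dw fw m = kappa σw dw fw g := by
  obtain ⟨a, b, t', ha, hb, hact, rfl⟩ := h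
  exact kappa_diag_mul σw dw fw g t' a b ha hb hact

section fields

variable (arith : ℕ → Orb → Prop) (γ₀ : Orb)

/-- **`hout` from the local translate condition**: on the support, some torus translate of `γ` at `w` is integral -/
theorem hout_field_local (hψ : ∀ x, ψ (σ x) = σw (ψ x)) (hw : ∀ x : K, w x = abv (ψ (algebraMap K E x)))
    (hκ : ∀ γ, algebraMap K E (κF γ) = kappa σ d f (matO γ)) (hna : IsNonarchimedean abv)
    (hσ : ∀ x, abv (σw x) = abv x) (hf : ∀ i, abv (ψ (f 0 i)) ≤ 1) (hd : abv (ψ (d 0)) ≤ 1)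
    (hdisc : abv (ψ (d 0) * disc' σw (fun i => ψ (d i)) (fun j i => ψ (f j i)) 0) = 1)
    (hγ₀ : ∃ m₀, IsTranslate σw (fun j i => ψ (f j i)) ((matO γ₀).map ψ) m₀ ∧ ∀ i j, abv (m₀ i j) ≤ 1)
    (hsupp : ∀ N γ, arith N γ → ∃ m, IsTranslate σw (fun j i => ψ (f j i)) ((matO γ).map ψ) m ∧
      ∀ i j, abv (m i j) ≤ 1) :
    ∀ N γ, arith N γ → w (κF γ - κF γ₀) ≤ 1 := by
  intro N γ hγ
  obtain ⟨m, hm, hmint⟩ := hsupp N γ hγ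
  obtain ⟨m₀, hm₀, hm₀int⟩ := hγ₀
  rw [place_sub_eq_abv_local σ σw ψ abv d f matO κF w hψ hw hκ,
    ← kappa_eq_of_isTranslate σw (fun i => ψ (d i)) _ hm, ← kappa_eq_of_isTranslate σw (fun i => ψ (d i)) _ hm₀]
  exact abv_kappa_sub_kappa_le_one σw abv hna hσ _ _ m m₀ hmint hm₀int hf hd hdisc

/-- **`hS` from the local translate condition**: on the support, some torus translate of `γ` at `w` has entries `≤ M` -/
theorem hS_field_local (hψ : ∀ x, ψ (σ x) = σw (ψ x)) (hw : ∀ x : K, w x = abv (ψ (algebraMap K E x)))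
    (hκ : ∀ γ, algebraMap K E (κF γ) = kappa σ d f (matO γ)) (hna : IsNonarchimedean abv)
    (hσ : ∀ x, abv (σw x) = abv x) {M : ℝ} (hM : 0 ≤ M) (hf : ∀ i, abv (ψ (f 0 i)) ≤ M)
    (hd : abv (ψ (d 0)) ≤ M)
    (hγ₀ : ∃ m₀, IsTranslate σw (fun j i => ψ (f j i)) ((matO γ₀).map ψ) m₀ ∧ ∀ i j, abv (m₀ i j) ≤ M)
    (hsupp : ∀ N γ, arith N γ → ∃ m, IsTranslate σw (fun j i => ψ (f j i)) ((matO γ).map ψ) m ∧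
      ∀ i j, abv (m i j) ≤ M) :
    ∀ N γ, arith N γ → w (κF γ - κF γ₀) ≤
      M ^ 6 / abv (ψ (d 0) * disc' σw (fun i => ψ (d i)) (fun j i => ψ (f j i)) 0) := by
  intro N γ hγ
  obtain ⟨m, hm, hmb⟩ := hsupp N γ hγ
  obtain ⟨m₀, hm₀, hm₀b⟩ := hγ₀
  rw [place_sub_eq_abv_local σ σw ψ abv d f matO κF w hψ hw hκ,
    ← kappa_eq_of_isTranslate σw (fun i => ψ (d i)) _ hm, ← kappa_eq_of_isTranslate σw (fun i => ψ (d i)) _ hm₀]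
  have h1 := abv_kappa_le σw abv hna hσ (fun i => ψ (d i)) (fun j i => ψ (f j i)) m hM hmb hf hd
  have h2 := abv_kappa_le σw abv hna hσ (fun i => ψ (d i)) (fun j i => ψ (f j i)) m₀ hM hm₀b hf hd
  have h := hna (kappa σw (fun i => ψ (d i)) (fun j i => ψ (f j i)) m)
    (-(kappa σw (fun i => ψ (d i)) (fun j i => ψ (f j i)) m₀))
  rw [← sub_eq_add_neg, abv.map_neg] at h
  exact h.trans (max_le h1 h2)

/-- **`hcong` from the local translate condition at `v₁`**: on the support, some torus translate of `γ` at `w` is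
`γ₀_w · k` with `k ≡ 1 mod q⁻¹ ^ N`, for a fixed integral local representative `γ₀_w` of the distinguished coset -/
theorem hcong_field_local (hψ : ∀ x, ψ (σ x) = σw (ψ x)) (hw : ∀ x : K, w x = abv (ψ (algebraMap K E x)))
    (hκ : ∀ γ, algebraMap K E (κF γ) = kappa σ d f (matO γ)) (hna : IsNonarchimedean abv)
    (hσ : ∀ x, abv (σw x) = abv x) (hf : ∀ i, abv (ψ (f 0 i)) ≤ 1) (hd : abv (ψ (d 0)) ≤ 1)
    (hdisc : abv (ψ (d 0) * disc' σw (fun i => ψ (d i)) (fun j i => ψ (f j i)) 0) = 1) {q : ℝ} (hq : 1 < q)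
    (γ₀w : Matrix (Fin 2) (Fin 2) Ew) (hγ₀ : IsTranslate σw (fun j i => ψ (f j i)) ((matO γ₀).map ψ) γ₀w)
    (hγ₀int : ∀ i j, abv (γ₀w i j) ≤ 1)
    (hsupp : ∀ N γ, arith N γ → ∃ k : Matrix (Fin 2) (Fin 2) Ew,
      IsTranslate σw (fun j i => ψ (f j i)) ((matO γ).map ψ) (γ₀w * k) ∧ ∀ i j, abv ((k - 1) i j) ≤ q⁻¹ ^ N) :
    ∀ N γ, arith N γ → w (κF γ - κF γ₀) ≤ q⁻¹ ^ N := by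
  intro N γ hγ
  obtain ⟨k, hm, hk⟩ := hsupp N γ hγ
  rw [place_sub_eq_abv_local σ σw ψ abv d f matO κF w hψ hw hκ,
    ← kappa_eq_of_isTranslate σw (fun i => ψ (d i)) _ hm, ← kappa_eq_of_isTranslate σw (fun i => ψ (d i)) _ hγ₀]
  have h := abv_kappa_mul_sub_kappa_le_pow σw abv hna hσ (fun i => ψ (d i)) (fun j i => ψ (f j i)) γ₀w k hq N
    le_rfl hk hγ₀int hf hd
  rwa [hdisc, one_pow, div_one, one_mul] at h

end fields

end Summit.Ventures.HodgeRepro2.Tier7.Line3.KappaDataFinLocal
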